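import Literature.Analysis.Fourier.TorusDescendCalculus
import Literature.Analysis.FunctionSpaces.TorusScalarFourierSeries

/-!
# Route `KLProgramme`, crux K3 — engine-flow child (stmt-HubbardSuperconductivity-20437), stub (C) at `n = 0`, located item #22a «(C)-SCALE0-PT2»:
# THE MID-SHELL FAR GAP, KIT-FREE — part 1: the fourth jet of the resolvent along a lattice line, iterated directional derivatives as
# derivatives along the line, and the Sobolev (Parseval) bound of a torus function's coefficients from a sup of `∂ⱼ^m`

Seat hubbard-kl-k3c5-p1 (g18; owner of #22a).  On the frequency shell `klE0 ≤ |ω|` the ultraviolet weight of the scale-0 symbol is `≡ 1`, so the spatial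
symbol is the PURE RESOLVENT `y ↦ 1/(−iω + e₀(2πy) − μ)`, `e₀(k) = −2(cos k₀ + cos k₁)`; along the lattice line `y + s·e_j` it is the one-variable function
`s ↦ 1/(K + c(y_j + s))`, `c(x) = −2cos(2πx)`, `K = −iω + c(y_{1−j}) − μ` (`Im K = −ω ≠ 0`).  Its fourth derivative is explicit and `O(|ω|⁻⁵)`; by Parseval
for `∂ⱼ⁴` of the descended symbol, `Σ_k k_j⁸‖a(k)‖² ≤ (2π)⁻⁸·sup‖∂ⱼ⁴‖²`, whence the far Parseval gaps beyond `‖z‖∞ > Rc` are `O(Rc⁻⁶)` — the companion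
`…ScaleZeroMidShellFarGap` assembles that into the outer-shell certificate hypothesis `hrmid` of `…SunsetCertRowsThreeShellsRecords.sunsetRows_of_records3_farSup`.
This file (generic / one-dimensional, everything proved):
* §1 `MidShell.ccl … ccl4`, `MidShell.resD`, `MidShell.res0 … res4` — the complex cosine line `c(z) = −2cos(2πz)`, its four derivatives, the denominator
  `D_K(z) = K + c(z)` and the explicit jet `R₀ = 1/D, R₁ = R₀′, …, R₄ = R₀⁗` (`R₄ = 24c′⁴/D⁵ − 36c′²c″/D⁴ + (6c″² + 8c′c‴)/D³ − c⁗/D²`);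
  `hasDerivAt_res0 … hasDerivAt_res3`; on the real line `iteratedDeriv_four_res0_real` (`(d/ds)⁴ R₀(K, a+s) = R₄(K, a+s)` when `Im K ≠ 0`) and the sup bound
  `norm_res4_real_le` (`‖R₄‖ ≤ 24(4π)⁴/m⁵ + 36(4π)²(8π²)/m⁴ + (6(8π²)² + 8(4π)(16π³))/m³ + 32π⁴/m²`, `m = |Im K|`);
* §2 `dirIter_eq_iteratedDeriv_line` — for smooth `G` on a normed space, `(∂_v)^m G (y) = (d/dt)^m|_{t=0} G(y + t v)`;
* §3 `tsum_pow_mul_normSq_mFourierCoeff_le` — for smooth `G` on `T²` with `‖∂ⱼ^m G‖ ≤ B`: `Σ_k (k_j²)^m·‖𝓕G(k)‖² ≤ B²/(2π)^{2m}` (and summability).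
References: Grafakos 2014 Prop. 3.2.6 (8), Prop. 3.2.7 (3), Thm. 3.3.9 [cite: Grafakos2014]; BGM 2006 §2.3, §3 (3.2) [cite: BenfattoGiulianiMastropietro2006].
-/

noncomputable section

namespace Summit.HubbardSuperconductivity.HubbardSuperconductivity.Theorems.KLRegimeSplit

set_option linter.dupNamespace false -- summit = problem name (single-conjunct summit), D-0017

open Literature.Analysis.FunctionSpaces Literature.Analysis.Fourier Literature.Algebra.EuclideanLattices
open MeasureTheory Complex UnitAddTorus Real

namespace MidShell

/-! ## §1 The fourth jet of the resolvent along a cosine line -/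

/-- The cosine line as a complex function: `c(z) = −2cos(2πz)`. [cite: BenfattoGiulianiMastropietro2006, §2.3] -/
def ccl (z : ℂ) : ℂ := -2 * Complex.cos (2 * π * z)
/-- `c′(z) = 4π·sin(2πz)`. [cite: BenfattoGiulianiMastropietro2006, §2.3] -/
def ccl1 (z : ℂ) : ℂ := 4 * π * Complex.sin (2 * π * z)
/-- `c″(z) = 8π²·cos(2πz)`. [cite: BenfattoGiulianiMastropietro2006, §2.3] -/
def ccl2 (z : ℂ) : ℂ := 8 * π ^ 2 * Complex.cos (2 * π * z)
/-- `c‴(z) = −16π³·sin(2πz)`. [cite: BenfattoGiulianiMastropietro2006, §2.3] -/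
def ccl3 (z : ℂ) : ℂ := -(16 * π ^ 3 * Complex.sin (2 * π * z))
/-- `c⁗(z) = −32π⁴·cos(2πz)`. [cite: BenfattoGiulianiMastropietro2006, §2.3] -/
def ccl4 (z : ℂ) : ℂ := -(32 * π ^ 4 * Complex.cos (2 * π * z))

/-- The inner affine map `z ↦ 2πz` has derivative `2π`. [folklore] -/
theorem hasDerivAt_two_pi_mul (z : ℂ) : HasDerivAt (fun w : ℂ => 2 * (π : ℂ) * w) (2 * π) z := by
  simpa using (hasDerivAt_id z).const_mul (2 * (π : ℂ))

/-- `c′ = ccl1`. [cite: BenfattoGiulianiMastropietro2006, §2.3] -/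
theorem hasDerivAt_ccl (z : ℂ) : HasDerivAt ccl (ccl1 z) z := by
  have h := ((Complex.hasDerivAt_cos (2 * π * z)).comp z (hasDerivAt_two_pi_mul z)).const_mul (-2 : ℂ)
  have e : -2 * (-Complex.sin (2 * π * z) * (2 * π)) = ccl1 z := by simp only [ccl1]; ring
  rw [e] at h
  exact h

/-- `c″ = ccl2`. [cite: BenfattoGiulianiMastropietro2006, §2.3] -/
theorem hasDerivAt_ccl1 (z : ℂ) : HasDerivAt ccl1 (ccl2 z) z := by
  have h := ((Complex.hasDerivAt_sin (2 * π * z)).comp z (hasDerivAt_two_pi_mul z)).const_mul (4 * (π : ℂ))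
  have e : 4 * (π : ℂ) * (Complex.cos (2 * π * z) * (2 * π)) = ccl2 z := by simp only [ccl2]; ring
  rw [e] at h
  exact h

/-- `c‴ = ccl3`. [cite: BenfattoGiulianiMastropietro2006, §2.3] -/
theorem hasDerivAt_ccl2 (z : ℂ) : HasDerivAt ccl2 (ccl3 z) z := by
  have h := ((Complex.hasDerivAt_cos (2 * π * z)).comp z (hasDerivAt_two_pi_mul z)).const_mul (8 * (π : ℂ) ^ 2)
  have e : 8 * (π : ℂ) ^ 2 * (-Complex.sin (2 * π * z) * (2 * π)) = ccl3 z := by simp only [ccl3]; ring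
  rw [e] at h
  exact h

/-- `c⁗ = ccl4`. [cite: BenfattoGiulianiMastropietro2006, §2.3] -/
theorem hasDerivAt_ccl3 (z : ℂ) : HasDerivAt ccl3 (ccl4 z) z := by
  have h := (((Complex.hasDerivAt_sin (2 * π * z)).comp z (hasDerivAt_two_pi_mul z)).const_mul (16 * (π : ℂ) ^ 3)).neg
  have e : -(16 * (π : ℂ) ^ 3 * (Complex.cos (2 * π * z) * (2 * π))) = ccl4 z := by simp only [ccl4]; ring
  rw [e] at h
  exact h

/-- The denominator `D_K(z) = K + c(z)`. [cite: BenfattoGiulianiMastropietro2006, §2.3] -/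
def resD (K z : ℂ) : ℂ := K + ccl z
/-- `R₀ = 1/D`. [cite: BenfattoGiulianiMastropietro2006, §2.3] -/
def res0 (K z : ℂ) : ℂ := 1 / resD K z
/-- `R₁ = R₀′ = −c′/D²`. [cite: BenfattoGiulianiMastropietro2006, §2.3] -/
def res1 (K z : ℂ) : ℂ := -ccl1 z / resD K z ^ 2
/-- `R₂ = R₀″ = 2c′²/D³ − c″/D²`. [cite: BenfattoGiulianiMastropietro2006, §2.3] -/
def res2 (K z : ℂ) : ℂ := 2 * ccl1 z ^ 2 / resD K z ^ 3 - ccl2 z / resD K z ^ 2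
/-- `R₃ = R₀‴ = −6c′³/D⁴ + 6c′c″/D³ − c‴/D²`. [cite: BenfattoGiulianiMastropietro2006, §2.3] -/
def res3 (K z : ℂ) : ℂ := -(6 * ccl1 z ^ 3) / resD K z ^ 4 + 6 * ccl1 z * ccl2 z / resD K z ^ 3 - ccl3 z / resD K z ^ 2
/-- `R₄ = R₀⁗ = 24c′⁴/D⁵ − 36c′²c″/D⁴ + (6c″² + 8c′c‴)/D³ − c⁗/D²`. [cite: BenfattoGiulianiMastropietro2006, §2.3] -/
def res4 (K z : ℂ) : ℂ :=
  24 * ccl1 z ^ 4 / resD K z ^ 5 - 36 * ccl1 z ^ 2 * ccl2 z / resD K z ^ 4 +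
    (6 * ccl2 z ^ 2 + 8 * ccl1 z * ccl3 z) / resD K z ^ 3 - ccl4 z / resD K z ^ 2

/-- `D′ = c′`. [cite: BenfattoGiulianiMastropietro2006, §2.3] -/
theorem hasDerivAt_resD (K z : ℂ) : HasDerivAt (resD K) (ccl1 z) z := by
  have h := (hasDerivAt_ccl z).const_add K
  exact h

/-- `R₀′ = R₁` (where `D ≠ 0`). [cite: BenfattoGiulianiMastropietro2006, §2.3] -/
theorem hasDerivAt_res0 (K : ℂ) {z : ℂ} (hz : resD K z ≠ 0) : HasDerivAt (res0 K) (res1 K z) z := by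
  have h := (hasDerivAt_const z (1 : ℂ)).div (hasDerivAt_resD K z) hz
  have h' : HasDerivAt (res0 K) _ z := h
  refine h'.congr_deriv ?_
  simp only [res1]
  ring

/-- `R₁′ = R₂` (where `D ≠ 0`). [cite: BenfattoGiulianiMastropietro2006, §2.3] -/
theorem hasDerivAt_res1 (K : ℂ) {z : ℂ} (hz : resD K z ≠ 0) : HasDerivAt (res1 K) (res2 K z) z := by
  have hD := hasDerivAt_resD K z
  have h := ((hasDerivAt_ccl1 z).neg).div (hD.pow 2) (pow_ne_zero 2 hz)
  have h' : HasDerivAt (res1 K) _ z := h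
  refine h'.congr_deriv ?_
  simp only [res2, Pi.neg_apply, Pi.pow_apply]
  field_simp
  ring

/-- `R₂′ = R₃` (where `D ≠ 0`). [cite: BenfattoGiulianiMastropietro2006, §2.3] -/
theorem hasDerivAt_res2 (K : ℂ) {z : ℂ} (hz : resD K z ≠ 0) : HasDerivAt (res2 K) (res3 K z) z := by
  have hD := hasDerivAt_resD K z
  have h1 := (((hasDerivAt_ccl1 z).pow 2).const_mul (2 : ℂ)).div (hD.pow 3) (pow_ne_zero 3 hz)
  have h2 := (hasDerivAt_ccl2 z).div (hD.pow 2) (pow_ne_zero 2 hz)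
  have h := h1.sub h2
  have h' : HasDerivAt (res2 K) _ z := h
  refine h'.congr_deriv ?_
  simp only [res3, Pi.pow_apply]
  field_simp
  ring

/-- `R₃′ = R₄` (where `D ≠ 0`). [cite: BenfattoGiulianiMastropietro2006, §2.3] -/
theorem hasDerivAt_res3 (K : ℂ) {z : ℂ} (hz : resD K z ≠ 0) : HasDerivAt (res3 K) (res4 K z) z := by
  have hD := hasDerivAt_resD K z
  have h1 := ((((hasDerivAt_ccl1 z).pow 3).const_mul (6 : ℂ)).neg).div (hD.pow 4) (pow_ne_zero 4 hz)
  have h2 := ((((hasDerivAt_ccl1 z).const_mul (6 : ℂ)).mul (hasDerivAt_ccl2 z))).div (hD.pow 3) (pow_ne_zero 3 hz)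
  have h3 := (hasDerivAt_ccl3 z).div (hD.pow 2) (pow_ne_zero 2 hz)
  have h := (h1.add h2).sub h3
  have h' : HasDerivAt (res3 K) _ z := h
  refine h'.congr_deriv ?_
  simp only [res4, Pi.neg_apply, Pi.pow_apply, Pi.mul_apply]
  field_simp
  ring

/-- On a horizontal line `z = a + s` (`a, s` real) the cosine line is real, so `Im D_K = Im K`; hence `D_K ≠ 0` when `Im K ≠ 0`.
[cite: BenfattoGiulianiMastropietro2006, §2.3] -/
theorem im_resD_ofReal (K : ℂ) (t : ℝ) : (resD K t).im = K.im := by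
  have h : (Complex.cos (2 * π * (t : ℂ))).im = 0 := by
    rw [show (2 : ℂ) * π * t = ((2 * π * t : ℝ) : ℂ) by push_cast; ring]
    exact Complex.cos_ofReal_im _
  simp [resD, ccl, Complex.mul_im, h]

/-- `‖D_K(t)‖ ≥ |Im K|` on the real line. [cite: BenfattoGiulianiMastropietro2006, §2.3] -/
theorem abs_im_le_norm_resD (K : ℂ) (t : ℝ) : |K.im| ≤ ‖resD K t‖ := by
  rw [← im_resD_ofReal K t]
  exact Complex.abs_im_le_norm _

/-- `D_K(t) ≠ 0` on the real line when `Im K ≠ 0`. [cite: BenfattoGiulianiMastropietro2006, §2.3] -/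
theorem resD_ofReal_ne_zero {K : ℂ} (hK : K.im ≠ 0) (t : ℝ) : resD K t ≠ 0 := by
  intro h
  have := im_resD_ofReal K t
  rw [h, Complex.zero_im] at this
  exact hK this.symm

/-- **The fourth derivative along the real line**: for `Im K ≠ 0` and real `a`,
`iteratedDeriv 4 (s ↦ R₀(K, a + s)) = s ↦ R₄(K, a + s)`. [cite: BenfattoGiulianiMastropietro2006, §2.3] -/
theorem iteratedDeriv_four_res0_real {K : ℂ} (hK : K.im ≠ 0) (a : ℝ) :
    iteratedDeriv 4 (fun s : ℝ => res0 K ((a : ℂ) + s)) = fun s : ℝ => res4 K ((a : ℂ) + s) := by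
  -- the line `s ↦ a + s` as a complex-valued map of derivative `1`
  have hline : ∀ s : ℝ, HasDerivAt (fun s : ℝ => ((a : ℂ) + s)) 1 s := fun s => by
    simpa using ((hasDerivAt_id s).ofReal_comp).const_add (a : ℂ)
  have hne : ∀ s : ℝ, resD K ((a : ℂ) + s) ≠ 0 := fun s => by
    have := resD_ofReal_ne_zero hK (a + s); push_cast at this; exact this
  have d0 : deriv (fun s : ℝ => res0 K ((a : ℂ) + s)) = fun s : ℝ => res1 K ((a : ℂ) + s) := by
    funext s
    have h := (hasDerivAt_res0 K (hne s)).comp s (hline s)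
    rw [mul_one] at h
    exact h.deriv
  have d1 : deriv (fun s : ℝ => res1 K ((a : ℂ) + s)) = fun s : ℝ => res2 K ((a : ℂ) + s) := by
    funext s
    have h := (hasDerivAt_res1 K (hne s)).comp s (hline s)
    rw [mul_one] at h
    exact h.deriv
  have d2 : deriv (fun s : ℝ => res2 K ((a : ℂ) + s)) = fun s : ℝ => res3 K ((a : ℂ) + s) := by
    funext s
    have h := (hasDerivAt_res2 K (hne s)).comp s (hline s)
    rw [mul_one] at h
    exact h.deriv
  have d3 : deriv (fun s : ℝ => res3 K ((a : ℂ) + s)) = fun s : ℝ => res4 K ((a : ℂ) + s) := by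
    funext s
    have h := (hasDerivAt_res3 K (hne s)).comp s (hline s)
    rw [mul_one] at h
    exact h.deriv
  rw [show (4 : ℕ) = 3 + 1 from rfl, iteratedDeriv_succ, show (3 : ℕ) = 2 + 1 from rfl, iteratedDeriv_succ,
    show (2 : ℕ) = 1 + 1 from rfl, iteratedDeriv_succ, iteratedDeriv_one]
  rw [d0, d1, d2, d3]

/-- Bounds of the cosine-line derivatives on the real line: `‖c′‖ ≤ 4π`, `‖c″‖ ≤ 8π²`, `‖c‴‖ ≤ 16π³`, `‖c⁗‖ ≤ 32π⁴`.
[cite: BenfattoGiulianiMastropietro2006, §2.3] -/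
theorem norm_ccl_derivs_le (t : ℝ) :
    ‖ccl1 t‖ ≤ 4 * π ∧ ‖ccl2 t‖ ≤ 8 * π ^ 2 ∧ ‖ccl3 t‖ ≤ 16 * π ^ 3 ∧ ‖ccl4 t‖ ≤ 32 * π ^ 4 := by
  have harg : (2 : ℂ) * π * t = ((2 * π * t : ℝ) : ℂ) := by push_cast; ring
  have hs : ‖Complex.sin (2 * π * t)‖ ≤ 1 := by
    rw [harg, ← Complex.ofReal_sin, Complex.norm_real, Real.norm_eq_abs]; exact Real.abs_sin_le_one _
  have hc : ‖Complex.cos (2 * π * t)‖ ≤ 1 := by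
    rw [harg, ← Complex.ofReal_cos, Complex.norm_real, Real.norm_eq_abs]; exact Real.abs_cos_le_one _
  have hπ : ‖(π : ℂ)‖ = π := by rw [Complex.norm_real, Real.norm_eq_abs, abs_of_pos Real.pi_pos]
  refine ⟨?_, ?_, ?_, ?_⟩
  · simp only [ccl1, norm_mul, Complex.norm_ofNat, hπ]
    nlinarith [Real.pi_pos]
  · simp only [ccl2, norm_mul, norm_pow, Complex.norm_ofNat, hπ]
    nlinarith [pow_pos Real.pi_pos 2]
  · simp only [ccl3, norm_neg, norm_mul, norm_pow, Complex.norm_ofNat, hπ]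
    nlinarith [pow_pos Real.pi_pos 3]
  · simp only [ccl4, norm_neg, norm_mul, norm_pow, Complex.norm_ofNat, hπ]
    nlinarith [pow_pos Real.pi_pos 4]

/-- **Sup bound of the fourth jet on the real line**: with `m := |Im K| > 0`,
`‖R₄(K, t)‖ ≤ 24(4π)⁴/m⁵ + 36(4π)²(8π²)/m⁴ + (6(8π²)² + 8(4π)(16π³))/m³ + 32π⁴/m²`. [cite: BenfattoGiulianiMastropietro2006, §2.3] -/
theorem norm_res4_real_le {K : ℂ} (hK : K.im ≠ 0) (t : ℝ) :
    ‖res4 K t‖ ≤ 24 * (4 * π) ^ 4 / |K.im| ^ 5 + 36 * (4 * π) ^ 2 * (8 * π ^ 2) / |K.im| ^ 4 +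
      (6 * (8 * π ^ 2) ^ 2 + 8 * (4 * π) * (16 * π ^ 3)) / |K.im| ^ 3 + 32 * π ^ 4 / |K.im| ^ 2 := by
  obtain ⟨h1, h2, h3, h4⟩ := norm_ccl_derivs_le t
  have hm : 0 < |K.im| := abs_pos.2 hK
  have hD : |K.im| ≤ ‖resD K t‖ := abs_im_le_norm_resD K t
  have hDpos : 0 < ‖resD K t‖ := lt_of_lt_of_le hm hD
  -- each term
  have tA : ‖24 * ccl1 (t : ℂ) ^ 4 / resD K t ^ 5‖ ≤ 24 * (4 * π) ^ 4 / |K.im| ^ 5 := by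
    rw [norm_div, norm_mul, norm_pow, norm_pow, Complex.norm_ofNat]
    rw [div_le_div_iff₀ (by positivity) (by positivity)]
    have := pow_le_pow_left₀ (norm_nonneg _) h1 4
    calc 24 * ‖ccl1 (t : ℂ)‖ ^ 4 * |K.im| ^ 5 ≤ 24 * (4 * π) ^ 4 * |K.im| ^ 5 := by gcongr
      _ ≤ 24 * (4 * π) ^ 4 * ‖resD K ↑t‖ ^ 5 := by gcongr
  have tB : ‖36 * ccl1 (t : ℂ) ^ 2 * ccl2 t / resD K t ^ 4‖ ≤ 36 * (4 * π) ^ 2 * (8 * π ^ 2) / |K.im| ^ 4 := by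
    rw [norm_div, norm_mul, norm_mul, norm_pow, norm_pow, Complex.norm_ofNat]
    rw [div_le_div_iff₀ (by positivity) (by positivity)]
    have := pow_le_pow_left₀ (norm_nonneg _) h1 2
    calc 36 * ‖ccl1 (t : ℂ)‖ ^ 2 * ‖ccl2 (t : ℂ)‖ * |K.im| ^ 4 ≤ 36 * (4 * π) ^ 2 * (8 * π ^ 2) * |K.im| ^ 4 := by gcongr
      _ ≤ 36 * (4 * π) ^ 2 * (8 * π ^ 2) * ‖resD K ↑t‖ ^ 4 := by gcongr
  have tC : ‖(6 * ccl2 (t : ℂ) ^ 2 + 8 * ccl1 t * ccl3 t) / resD K t ^ 3‖ ≤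
      (6 * (8 * π ^ 2) ^ 2 + 8 * (4 * π) * (16 * π ^ 3)) / |K.im| ^ 3 := by
    rw [norm_div, norm_pow]
    have hnum : ‖6 * ccl2 (t : ℂ) ^ 2 + 8 * ccl1 t * ccl3 t‖ ≤ 6 * (8 * π ^ 2) ^ 2 + 8 * (4 * π) * (16 * π ^ 3) := by
      refine (norm_add_le _ _).trans (add_le_add ?_ ?_)
      · rw [norm_mul, norm_pow, Complex.norm_ofNat]
        have := pow_le_pow_left₀ (norm_nonneg _) h2 2
        gcongr
      · rw [norm_mul, norm_mul, Complex.norm_ofNat]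
        gcongr
    rw [div_le_div_iff₀ (by positivity) (by positivity)]
    calc ‖6 * ccl2 (t : ℂ) ^ 2 + 8 * ccl1 ↑t * ccl3 ↑t‖ * |K.im| ^ 3
        ≤ (6 * (8 * π ^ 2) ^ 2 + 8 * (4 * π) * (16 * π ^ 3)) * |K.im| ^ 3 := by gcongr
      _ ≤ (6 * (8 * π ^ 2) ^ 2 + 8 * (4 * π) * (16 * π ^ 3)) * ‖resD K ↑t‖ ^ 3 := by gcongr
  have tD : ‖ccl4 (t : ℂ) / resD K t ^ 2‖ ≤ 32 * π ^ 4 / |K.im| ^ 2 := by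
    rw [norm_div, norm_pow, div_le_div_iff₀ (by positivity) (by positivity)]
    calc ‖ccl4 (t : ℂ)‖ * |K.im| ^ 2 ≤ 32 * π ^ 4 * |K.im| ^ 2 := by gcongr
      _ ≤ 32 * π ^ 4 * ‖resD K ↑t‖ ^ 2 := by gcongr
  unfold res4
  calc ‖24 * ccl1 (t : ℂ) ^ 4 / resD K ↑t ^ 5 - 36 * ccl1 ↑t ^ 2 * ccl2 ↑t / resD K ↑t ^ 4 +
          (6 * ccl2 ↑t ^ 2 + 8 * ccl1 ↑t * ccl3 ↑t) / resD K ↑t ^ 3 - ccl4 ↑t / resD K ↑t ^ 2‖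
      ≤ ‖24 * ccl1 (t : ℂ) ^ 4 / resD K ↑t ^ 5‖ + ‖36 * ccl1 ↑t ^ 2 * ccl2 ↑t / resD K ↑t ^ 4‖ +
          ‖(6 * ccl2 ↑t ^ 2 + 8 * ccl1 ↑t * ccl3 ↑t) / resD K ↑t ^ 3‖ + ‖ccl4 ↑t / resD K ↑t ^ 2‖ := by
        refine (norm_sub_le _ _).trans (add_le_add ((norm_add_le _ _).trans (add_le_add (norm_sub_le _ _) le_rfl)) le_rfl)
    _ ≤ _ := by linarith [tA, tB, tC, tD]

end MidShell

/-! ## §2 Iterated directional derivatives as derivatives along the line -/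

/-- **`(∂_v)^m G (y) = (d/dt)^m|_{t=0} G(y + t·v)`** for a smooth `G` on a normed space (induction: `∂_v` of a smooth `H` is the `t`-derivative of
`H(y + t v)` at `0`, and translating the line shifts the variable). [cite: Grafakos2014, §3.1.1] -/
theorem dirIter_eq_iteratedDeriv_line {V : Type*} [NormedAddCommGroup V] [NormedSpace ℝ V] {G : V → ℂ}
    (hG : ContDiff ℝ (⊤ : ℕ∞) G) (v : V) (m : ℕ) (y : V) :
    LatticePeriodic.dirIter v m G y = iteratedDeriv m (fun t : ℝ => G (y + t • v)) 0 := by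
  induction m generalizing y with
  | zero => simp [LatticePeriodic.dirIter]
  | succ m ih =>
    rw [LatticePeriodic.dirIter_succ]
    have hH : ContDiff ℝ (⊤ : ℕ∞) (LatticePeriodic.dirIter v m G) := LatticePeriodic.contDiff_dirIter hG v m
    have hdiff : DifferentiableAt ℝ (LatticePeriodic.dirIter v m G) y := (hH.differentiable (by simp)).differentiableAt
    show fderiv ℝ (LatticePeriodic.dirIter v m G) y v = iteratedDeriv (m + 1) (fun t : ℝ => G (y + t • v)) 0
    rw [← hdiff.lineDeriv_eq_fderiv, lineDeriv, iteratedDeriv_succ]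
    congr 1
    funext t
    rw [ih (y + t • v)]
    have hfun : (fun s : ℝ => G (y + t • v + s • v)) = fun s : ℝ => (fun r : ℝ => G (y + r • v)) (t + s) := by
      funext s; simp only [add_smul, add_assoc]
    rw [hfun, iteratedDeriv_comp_const_add m (fun r : ℝ => G (y + r • v)) t]
    simp

/-! ## §3 The Parseval bound of the coefficients from a sup of `∂ⱼ^m` -/

/-- **`Σ_k (k_j²)^m·‖𝓕G(k)‖² ≤ B²/(2π)^{2m}`** for a smooth `G : T² → ℂ` with `‖∂ⱼ^m G‖ ≤ B` everywhere: Parseval for the continuous `∂ⱼ^m G`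
(`𝓕(∂ⱼ^m G)(k) = (2πi k_j)^m 𝓕G(k)`) on the probability space `T²`; with summability of the weighted family. [cite: Grafakos2014, Prop. 3.2.7 (3)] -/
theorem tsum_pow_mul_normSq_mFourierCoeff_le {G : UnitAddTorus (Fin 2) → ℂ} (hG : Torus.IsSmooth G) (j : Fin 2) (m : ℕ) {B : ℝ}
    (hB : ∀ t, ‖((Torus.partialDeriv j)^[m] G) t‖ ≤ B) :
    Summable (fun k : Fin 2 → ℤ => (((k j : ℤ) : ℝ) ^ 2) ^ m * ‖mFourierCoeff G k‖ ^ 2) ∧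
      ∑' k : Fin 2 → ℤ, (((k j : ℤ) : ℝ) ^ 2) ^ m * ‖mFourierCoeff G k‖ ^ 2 ≤ B ^ 2 / (2 * π) ^ (2 * m) := by
  classical
  set H : UnitAddTorus (Fin 2) → ℂ := (Torus.partialDeriv j)^[m] G with hH
  have hHs : Torus.IsSmooth H := Torus.isSmooth_partialDeriv_iterate hG j m
  have hHc : Continuous H := hHs.continuous
  have hP := Torus.hasSum_sq_mFourierCoeff_of_continuous hHc
  -- coefficients of `H`
  have hcoef : ∀ k : Fin 2 → ℤ, ‖mFourierCoeff H k‖ ^ 2 = (2 * π) ^ (2 * m) * ((((k j : ℤ) : ℝ) ^ 2) ^ m * ‖mFourierCoeff G k‖ ^ 2) := by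
    intro k
    rw [hH, Torus.mFourierCoeff_partialDeriv_iterate hG j m k, norm_smul, norm_pow]
    have : ‖2 * (π : ℂ) * Complex.I * ((k j : ℤ) : ℂ)‖ = 2 * π * |((k j : ℤ) : ℝ)| := by
      rw [norm_mul, norm_mul, norm_mul, Complex.norm_I, mul_one, Complex.norm_two, Complex.norm_real, Real.norm_eq_abs,
        abs_of_pos Real.pi_pos, ← Int.cast_abs, Complex.norm_intCast, Int.cast_abs]
    rw [this]
    have hk : (|((k j : ℤ) : ℝ)| ^ 2) ^ m = (((k j : ℤ) : ℝ) ^ 2) ^ m := by rw [sq_abs]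
    calc ((2 * π * |((k j : ℤ) : ℝ)|) ^ m * ‖mFourierCoeff G k‖) ^ 2
        = (2 * π) ^ (2 * m) * ((|((k j : ℤ) : ℝ)| ^ 2) ^ m * ‖mFourierCoeff G k‖ ^ 2) := by ring
      _ = _ := by rw [hk]
  -- the integral of `‖H‖²` on the probability space is at most `B²`
  have hint : (∫ x, ‖H x‖ ^ 2) ≤ B ^ 2 := by
    have hle : ∀ x, ‖H x‖ ^ 2 ≤ B ^ 2 := fun x => pow_le_pow_left₀ (norm_nonneg _) (hB x) 2
    calc (∫ x, ‖H x‖ ^ 2) ≤ ∫ _x : UnitAddTorus (Fin 2), B ^ 2 := by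
          refine integral_mono_of_nonneg (Filter.Eventually.of_forall fun x => by positivity) (integrable_const _)
            (Filter.Eventually.of_forall hle)
      _ = B ^ 2 := by simp
  simp_rw [hcoef] at hP
  have hc0 : (0 : ℝ) < (2 * π) ^ (2 * m) := by positivity
  have h2 := hP.mul_left (((2 * π : ℝ) ^ (2 * m))⁻¹)
  simp_rw [← mul_assoc, inv_mul_cancel₀ hc0.ne', one_mul] at h2
  refine ⟨h2.summable, ?_⟩
  rw [h2.tsum_eq, le_div_iff₀ hc0, mul_comm]
  calc (2 * π) ^ (2 * m) * (((2 * π) ^ (2 * m))⁻¹ * ∫ x, ‖H x‖ ^ 2) = ∫ x, ‖H x‖ ^ 2 := by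
        rw [← mul_assoc, mul_inv_cancel₀ hc0.ne', one_mul]
    _ ≤ B ^ 2 := hint

end Summit.HubbardSuperconductivity.HubbardSuperconductivity.Theorems.KLRegimeSplit

end
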